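import Literature.NumberTheory.LFunctions.SiegelTatuzawaExplicit
import HarnessLib

/-!
# Real zeros of real `L`-functions by elementary means: the theorems of Hecke, Page, Landau and
# Tatuzawa with Pintz's constants (Pintz 1977, part VIII) — AS PRINTED

Topic `Literature/NumberTheory/LFunctions` (namespace `Literature.NumberTheory.LFunctions`, grouping
sub-namespace `Pintz1977RealZeros`). STATEMENT LAYER (D-0014) typed for the cells `parity-realchar`
(CONDITIONALS I.1 dictionary `L(1) ↔ δ`; SIEGEL INSTRUMENT comparators) and `landau-siegel` (§C),
next to the other parts of the series already in the tree: II `GreatestRealZeroElementary.lean`,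
III `DeuringPhenomenonElementary.lean`, IV `HeilbronnPhenomenonElementary.lean`.

Source: J. Pintz, *Elementary methods in the theory of `L`-functions, VIII. Real zeros of real
`L`-functions*, Acta Arith. **33** (1977) 89–98 [Pintz1977ElementaryVIII]. READ FIRST-HAND: the
matwbn scan `aa3318.pdf` (image-only; CCITT strips decoded and rendered in the typing seat's folder,
pages 89–97 read). p. 89: "The aim of this paper is to prove these theorems [Hecke, Landau, Page,
Siegel, Walfisz, Tatuzawa] in a new, simple, unique way. … without any hand computation, we also
improve the best constants in case of Landau's and of Page's theorem."

## The printed statements (§2, pp. 89–91)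

* **Theorem 1 (Siegel–Walfisz)** and **Theorem 3 (Siegel)** — ineffective; the tree PROVES Siegel's
  theorem (`SiegelTheorem*.lean`), not retyped.
* **Theorem 2 (Hecke).** "If `χ` is a real non-principal character `(mod D)`, and `L(s, χ)` has no
  zero in the interval `[1 − β, 1]` with `0 < β ≤ 1/log D`, then `L(1, χ) > (1 + o(1)) e^{−3/2} β`."
  (Proof p. 95: `0 < β ≤ 1/log D ≤ 1/10`; `o(1)` as `D → ∞`.)
* **Theorem 4 (Page).** "If `χ` is a real non-principal character `(mod D)`, then `L(s, χ)` has at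
  most one, simple zero in the interval `[1 − c/log D, 1]` where `c = 1 + o(1)` if we do not use the
  Pólya–Vinogradov inequality; and `c = 2 + o(1)` if we use it. (This was proved with these constants
  in paper V, where we noticed that with Burgess inequality we get even `c = 4 + o(1)`. The former best
  result, `c = 0.28` is due to Miech [2].)" — typed with `c = 2 + o(1)`; the Burgess remark is indexed
  only (no proof printed in VIII).
* **Theorem 5 (Landau).** "If `χ₁ ≠ χ₂` are real primitive characters `(mod D₁)` and `(mod D₂)`
  resp. and for real `δ₁, δ₂`: `L(1 − δ₁, χ₁) = L(1 − δ₂, χ₂) = 0` then `max(δ₁, δ₂) > c′/log D₁D₂`,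
  where `c′ = ½ + o(1)` if we do not use the Pólya–Vinogradov inequality; `c′ = 1 + o(1)` if we use
  it. (The former best result `c′ = 0.1` is due to Miech [2].)" — typed with `c′ = 1 + o(1)`, `o(1)`
  as `D₁D₂ → ∞` (proof p. 96: `A = A₀(ε)` large, `A ≍ D₁D₂` up to logarithms).
* **Theorem 6 (Tatuzawa).** "If `0 < ε ≤ 1/5`, `χ` is a real primitive character `(mod D)`, where
  `D ≥ D₀` (absolute effective constant) then (2.1) `L(s, χ) ≠ 0` for `s ∈ [1 − ε/7D^ε, 1]` and
  (2.2) `L(1, χ) > ε/35D^ε`, with the possible exception not more than one `D`, and one real primitive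
  character `(mod D)`."
* **Theorem 7 (Tatuzawa).** "If `0 < ε ≤ 1/5`, `−D < 0` is a fundamental discriminant, `D > D₀`
  (absolute effective constant), then for the class number `h(−D)` of the imaginary quadratic field with
  discriminant `−D` (2.3) `h(−D) > (ε/(35π)) D^{1/2−ε}` with the possible exception of at most one
  fundamental discriminant. If `h ≥ 1`, `D ≥ (2000 h (log h + 10))²` and `D > D₀` (absolute effective
  constant) then (2.4) `h(−D) > h` with the possible exception of at most one fundamental discriminant."
  (Proof p. 97: (2.3) from (2.2) and `h(−D) = (√D/π) L(1, χ_D)`, `D > 4`; (2.4) from (2.3) with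
  `ε = [2(log h + 10)]⁻¹`, so the exception in (2.4) depends on `h`.)

## How it is typed

* "real non-principal character mod `D`" = `χ.IsQuadratic ∧ χ ≠ 1`; "real primitive" adds
  `χ.IsPrimitive`; `L(σ, χ)` for real `σ` = `χ.LFunction (σ : ℂ)`; `L(1, χ)` (real for real `χ`) is
  compared through `(χ.LFunction 1).re`.
* `(1 + o(1))`, `c = 2 + o(1)`, `c′ = 1 + o(1)`: "for every `η > 0` there is `D₀(η)` beyond which the
  statement holds with `1 − η`, `2 − η`, `1 − η`" (the lower-bound direction the statements assert).
* "at most one, simple zero in `[1 − c/log D, 1]`": two DISTINCT real zeros have `min ≤ 1 − c/log D`,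
  and a real zero in the window has `L′ ≠ 0` (`deriv χ.LFunction`).
* `χ₁ ≠ χ₂` (different moduli allowed) = different value functions `(n ↦ χ₁ n) ≠ (n ↦ χ₂ n)`, the
  convention of `AtMostOneException` (`SiegelTatuzawaExplicit.lean`), which also renders Theorem 6's
  "exception of not more than one `D`, and one real primitive character `(mod D)`".
* Theorem 7 on number fields `K` with `[K:ℚ] = 2`, `d_K < 0`, `D = |d_K|`, `h(−D) = classNumber K`;
  "at most one exceptional fundamental discriminant" = `∃ d_e : ℤ, ∀ K, d_K ≠ d_e → …`.
* All `D₀` are rendered `∃ D₀` ("absolute effective": computability is not expressible here).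

## Contents

NAMED FACTS `pintz1977RealZeros_theorem2` (Hecke), `_theorem4` (Page, `c = 2 + o(1)`), `_theorem5`
(Landau, `c′ = 1 + o(1)`), `_theorem6` (Tatuzawa, zero-free interval and `L(1)`), `_theorem7a` ((2.3)),
`_theorem7b` ((2.4)). PROVED readings: `Pintz1977RealZeros.realZero_le_of_theorem6` (pairwise form of
(2.1): of two distinct real primitive characters of large moduli at least one has no real zero in its
window), `Pintz1977RealZeros.classNumber_gt_of_theorem7b` (pairwise form of (2.4)), and the printed
deductions `Pintz1977RealZeros.theorem7b_of_theorem7a` ((2.3) ⇒ (2.4), the computation (4.10) p. 97)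
and `Pintz1977RealZeros.theorem7a_of_theorem6` ((2.2) ⇒ (2.3) by the class number formula, p. 97; with
the utility `Pintz1977RealZeros.level_eq_of_isPrimitive_of_apply_natCast_eq`: primitive characters
with the same values on `ℕ` have the same level) — so Theorems 7 (2.3), (2.4) both follow from the
single named fact `pintz1977RealZeros_theorem6`.

Tree comparison (all PROVED there, smaller or inexplicit constants): Page `exists_min_realZeros_le`
(`LandauPageRealZeros.lean`, some `c > 0`), Landau `exists_landau_min_le`, Tatuzawa
`tatuzawa_realZero_atMostOne_modulus` (`TatuzawaRealZeros.lean`, constant `C ε⁵ q^{−ε}/1000`); explicit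
finite-range versions: Morrill–Trudgian `0.933` (`SingleCharacterPageExplicit.lean`), Thorner–Zaman
Lemma 2.4 (`landauConst = 0.31`). The facts below are the printed ASYMPTOTIC constants `2` and `1`.

LABEL (cell rule): statement layer; unconditional printed theorems with unspecified effective
thresholds, not re-proved; no compute.

## References

* [Pintz1977ElementaryVIII] Theorems 2, 4, 5, 6, 7, pp. 89–91; proofs §4 pp. 95–97.
* [Pintz1976ElementaryII], [Pintz1976ElementaryIV] (parts II, IV; typed in the sibling files).
* [Tatuzawa1951] (the original of Theorems 6–7; `tatuzawa1951_theorem2` in `SiegelTatuzawaExplicit.lean`).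
-/

noncomputable section

open Complex

namespace Literature.NumberTheory.LFunctions

/-! ### Theorem 2 (Hecke) -/

/-- **Pintz 1977 (VIII), Theorem 2 — Hecke's theorem with the constant `e^{−3/2}` (NAMED FACT, as
printed).** "If `χ` is a real non-principal character `(mod D)`, and `L(s, χ)` has no zero in the
interval `[1 − β, 1]` with `0 < β ≤ 1/log D`, then `L(1, χ) > (1 + o(1)) e^{−3/2} β`": for every
`η > 0` there is `D₀` such that for `D ≥ D₀` the conclusion holds with `(1 − η)`. Unproved here.
[cite: Pintz1977ElementaryVIII, Theorem 2 p. 89] -/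
def pintz1977RealZeros_theorem2 : Prop :=
  ∀ η : ℝ, 0 < η → ∃ D₀ : ℕ, ∀ (D : ℕ) [NeZero D], D₀ ≤ D → ∀ χ : DirichletCharacter ℂ D,
    χ.IsQuadratic → χ ≠ 1 → ∀ β : ℝ, 0 < β → β ≤ 1 / Real.log D →
      (∀ σ : ℝ, 1 - β ≤ σ → σ ≤ 1 → χ.LFunction (σ : ℂ) ≠ 0) →
        (1 - η) * Real.exp (-3 / 2) * β < (χ.LFunction 1).re

/-! ### Theorem 4 (Page) and Theorem 5 (Landau) with Pintz's constants -/

/-- **Pintz 1977 (VIII), Theorem 4 — Page's theorem with `c = 2 + o(1)` (NAMED FACT, as printed).**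
"If `χ` is a real non-principal character `(mod D)`, then `L(s, χ)` has at most one, simple zero in
the interval `[1 − c/log D, 1]` where … `c = 2 + o(1)` if we use [the Pólya–Vinogradov inequality]":
for every `η > 0` there is `D₀` such that for `D ≥ D₀` and `χ` real non-principal mod `D`, two
distinct real zeros satisfy `min ≤ 1 − (2 − η)/log D`, and a real zero `β ≥ 1 − (2 − η)/log D` is
simple. (p. 90: "with Burgess inequality we get even `c = 4 + o(1)`" — remark, not typed.) Unproved
here. [cite: Pintz1977ElementaryVIII, Theorem 4 p. 90] -/
def pintz1977RealZeros_theorem4 : Prop :=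
  ∀ η : ℝ, 0 < η → ∃ D₀ : ℕ, ∀ (D : ℕ) [NeZero D], D₀ ≤ D → ∀ χ : DirichletCharacter ℂ D,
    χ.IsQuadratic → χ ≠ 1 →
      (∀ β₁ β₂ : ℝ, β₁ ≠ β₂ → χ.LFunction (β₁ : ℂ) = 0 → χ.LFunction (β₂ : ℂ) = 0 →
          min β₁ β₂ ≤ 1 - (2 - η) / Real.log D) ∧
        (∀ β : ℝ, χ.LFunction (β : ℂ) = 0 → 1 - (2 - η) / Real.log D ≤ β →
          deriv χ.LFunction (β : ℂ) ≠ 0)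

/-- **Pintz 1977 (VIII), Theorem 5 — Landau's theorem with `c′ = 1 + o(1)` (NAMED FACT, as
printed).** "If `χ₁ ≠ χ₂` are real primitive characters `(mod D₁)` and `(mod D₂)` resp. and for real
`δ₁, δ₂`: `L(1 − δ₁, χ₁) = L(1 − δ₂, χ₂) = 0` then `max(δ₁, δ₂) > c′/log D₁D₂`, where … `c′ = 1 + o(1)`
if we use [Pólya–Vinogradov]": for every `η > 0` there is `A₀` such that the conclusion holds with
`c′ = 1 − η` whenever `D₁D₂ ≥ A₀`. `χ₁ ≠ χ₂` = different value functions. Unproved here.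
[cite: Pintz1977ElementaryVIII, Theorem 5 p. 90] -/
def pintz1977RealZeros_theorem5 : Prop :=
  ∀ η : ℝ, 0 < η → ∃ A₀ : ℕ, ∀ (D₁ D₂ : ℕ) [NeZero D₁] [NeZero D₂], A₀ ≤ D₁ * D₂ →
    ∀ (χ₁ : DirichletCharacter ℂ D₁) (χ₂ : DirichletCharacter ℂ D₂),
      χ₁.IsQuadratic → χ₁.IsPrimitive → χ₂.IsQuadratic → χ₂.IsPrimitive →
        ((fun n : ℕ ↦ χ₁ n) ≠ fun n : ℕ ↦ χ₂ n) →
          ∀ δ₁ δ₂ : ℝ, χ₁.LFunction ((1 - δ₁ : ℝ) : ℂ) = 0 → χ₂.LFunction ((1 - δ₂ : ℝ) : ℂ) = 0 →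
            (1 - η) / Real.log ((D₁ : ℝ) * D₂) < max δ₁ δ₂

/-! ### Theorems 6–7 (Tatuzawa) with the constants `1/7`, `1/35`, `2000` -/

/-- **Pintz 1977 (VIII), Theorem 6 — Tatuzawa's theorem, zero-free and `L(1)` forms (NAMED FACT, as
printed).** "If `0 < ε ≤ 1/5`, `χ` is a real primitive character `(mod D)`, where `D ≥ D₀` (absolute
effective constant) then (2.1) `L(s, χ) ≠ 0` for `s ∈ [1 − ε/7D^ε, 1]` and (2.2) `L(1, χ) > ε/35D^ε`,
with the possible exception not more than one `D`, and one real primitive character `(mod D)`."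
`D₀` is absolute (chosen before `ε`); the exception may depend on `ε`. Unproved here.
[cite: Pintz1977ElementaryVIII, Theorem 6 p. 90] -/
def pintz1977RealZeros_theorem6 : Prop :=
  ∃ D₀ : ℕ, ∀ ε : ℝ, 0 < ε → ε ≤ 1 / 5 →
    AtMostOneException fun D _ χ ↦ D₀ ≤ D →
      (∀ σ : ℝ, 1 - ε / (7 * (D : ℝ) ^ ε) ≤ σ → σ ≤ 1 → χ.LFunction (σ : ℂ) ≠ 0) ∧
        ε / (35 * (D : ℝ) ^ ε) < (χ.LFunction 1).re

/-- **Pintz 1977 (VIII), Theorem 7, (2.3) (NAMED FACT, as printed).** "If `0 < ε ≤ 1/5`, `−D < 0`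
is a fundamental discriminant, `D > D₀` (absolute effective constant), then …
`h(−D) > (ε/(35π)) D^{1/2−ε}` with the possible exception of at most one fundamental discriminant."
On imaginary quadratic fields `K`, `D = |d_K|`. Unproved here.
[cite: Pintz1977ElementaryVIII, Theorem 7 (2.3) p. 91] -/
def pintz1977RealZeros_theorem7a : Prop :=
  ∃ D₀ : ℕ, ∀ ε : ℝ, 0 < ε → ε ≤ 1 / 5 → ∃ dₑ : ℤ,
    ∀ (K : Type) [Field K] [NumberField K], Module.finrank ℚ K = 2 → NumberField.discr K < 0 →
      NumberField.discr K ≠ dₑ → D₀ < (NumberField.discr K).natAbs →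
        ε / (35 * Real.pi) * ((NumberField.discr K).natAbs : ℝ) ^ (1 / 2 - ε) <
          (NumberField.classNumber K : ℝ)

/-- **Pintz 1977 (VIII), Theorem 7, (2.4) (NAMED FACT, as printed).** "If `h ≥ 1`,
`D ≥ (2000 h (log h + 10))²` and `D > D₀` (absolute effective constant) then `h(−D) > h` with the
possible exception of at most one fundamental discriminant" (`−D < 0` fundamental; the exception may
depend on `h`, cf. the proof p. 97 with `ε = [2(log h + 10)]⁻¹`). Unproved here.
[cite: Pintz1977ElementaryVIII, Theorem 7 (2.4) p. 91] -/
def pintz1977RealZeros_theorem7b : Prop :=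
  ∃ D₀ : ℕ, ∀ h : ℕ, 1 ≤ h → ∃ dₑ : ℤ,
    ∀ (K : Type) [Field K] [NumberField K], Module.finrank ℚ K = 2 → NumberField.discr K < 0 →
      NumberField.discr K ≠ dₑ → D₀ < (NumberField.discr K).natAbs →
        (2000 * (h : ℝ) * (Real.log h + 10)) ^ 2 ≤ ((NumberField.discr K).natAbs : ℝ) →
          h < NumberField.classNumber K

namespace Pintz1977RealZeros

/-- **Pairwise reading of Theorem 6 (2.1)**: for `0 < ε ≤ 1/5` and two real primitive characters
`χ ≠ χ′` (different value functions) of moduli `D, D′ ≥ D₀`, at least one of `L(s, χ)`, `L(s, χ′)` has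
no real zero in its window `[1 − ε/(7D^ε), 1]`; hence if both have a real zero `β ≥ 1 − ε/(7D^ε)`,
`β′ ≥ 1 − ε/(7D′^ε)`, they are the same character. [cite: Pintz1977ElementaryVIII, Theorem 6 p. 90] -/
theorem realZero_le_of_theorem6 (h : pintz1977RealZeros_theorem6) :
    ∃ D₀ : ℕ, ∀ ε : ℝ, 0 < ε → ε ≤ 1 / 5 →
      ∀ {D : ℕ} [NeZero D] (χ : DirichletCharacter ℂ D), χ.IsPrimitive → χ.IsQuadratic → χ ≠ 1 →
      ∀ {D' : ℕ} [NeZero D'] (χ' : DirichletCharacter ℂ D'), χ'.IsPrimitive → χ'.IsQuadratic →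
        χ' ≠ 1 → ((fun n : ℕ ↦ χ n) ≠ fun n : ℕ ↦ χ' n) → D₀ ≤ D → D₀ ≤ D' →
        ∀ β β' : ℝ, χ.LFunction (β : ℂ) = 0 → χ'.LFunction (β' : ℂ) = 0 → β ≤ 1 → β' ≤ 1 →
          β < 1 - ε / (7 * (D : ℝ) ^ ε) ∨ β' < 1 - ε / (7 * (D' : ℝ) ^ ε) := by
  obtain ⟨D₀, hD₀⟩ := h
  refine ⟨D₀, fun ε hε hε5 D _ χ hp hq hne D' _ χ' hp' hq' hne' hdiff hD hD' β β' hz hz' hβ hβ' ↦ ?_⟩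
  rcases (hD₀ ε hε hε5).pairwise χ hp hq hne χ' hp' hq' hne' hdiff with hP | hP
  · left
    by_contra hlt
    exact (hP hD).1 β (not_lt.mp hlt) hβ hz
  · right
    by_contra hlt
    exact (hP hD').1 β' (not_lt.mp hlt) hβ' hz'

/-- **Pairwise reading of Theorem 7 (2.4)**: for `h ≥ 1`, of two imaginary quadratic fields with
DIFFERENT discriminants, both beyond `D₀` and `≥ (2000 h (log h + 10))²` in absolute value, at least one
has class number `> h`. [cite: Pintz1977ElementaryVIII, Theorem 7 (2.4) p. 91] -/
theorem classNumber_gt_of_theorem7b (h7 : pintz1977RealZeros_theorem7b) :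
    ∃ D₀ : ℕ, ∀ h : ℕ, 1 ≤ h →
      ∀ (K : Type) [Field K] [NumberField K] (K' : Type) [Field K'] [NumberField K'],
        Module.finrank ℚ K = 2 → NumberField.discr K < 0 → Module.finrank ℚ K' = 2 →
        NumberField.discr K' < 0 → NumberField.discr K ≠ NumberField.discr K' →
        D₀ < (NumberField.discr K).natAbs → D₀ < (NumberField.discr K').natAbs →
        (2000 * (h : ℝ) * (Real.log h + 10)) ^ 2 ≤ ((NumberField.discr K).natAbs : ℝ) →
        (2000 * (h : ℝ) * (Real.log h + 10)) ^ 2 ≤ ((NumberField.discr K').natAbs : ℝ) →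
          h < NumberField.classNumber K ∨ h < NumberField.classNumber K' := by
  obtain ⟨D₀, hD₀⟩ := h7
  refine ⟨D₀, fun h hh K _ _ K' _ _ h2 hd h2' hd' hne hD hD' hB hB' ↦ ?_⟩
  obtain ⟨dₑ, hdₑ⟩ := hD₀ h hh
  by_cases hK : NumberField.discr K = dₑ
  · right
    exact hdₑ K' h2' hd' (fun h' ↦ hne (hK.trans h'.symm)) hD' hB'
  · left
    exact hdₑ K h2 hd hK hD hB

/-- `log 2000 ≤ 8` (`e⁸ > 2.7⁸ > 2000`). [cite: Pintz1977ElementaryVIII, proof of Theorem 7, (4.10) p. 97] -/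
private theorem log_2000_le : Real.log 2000 ≤ 8 := by
  rw [Real.log_le_iff_le_exp (by norm_num)]
  have he := Real.exp_one_gt_d9
  have h8 : Real.exp 8 = Real.exp 1 ^ 8 := by rw [← Real.exp_nat_mul]; norm_num
  rw [h8]
  have h27 : (2.7 : ℝ) ≤ Real.exp 1 := by linarith
  calc (2000 : ℝ) ≤ 2.7 ^ 8 := by norm_num
    _ ≤ Real.exp 1 ^ 8 := by gcongr

/-- `2 ≤ log(2000/(70π))`, i.e. `70π e² ≤ 2000` (`π < 3.15`, `e < 2.7182818286`).
[cite: Pintz1977ElementaryVIII, proof of Theorem 7, (4.10) p. 97] -/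
private theorem two_le_log_div : 2 ≤ Real.log (2000 / (70 * Real.pi)) := by
  have hπ := Real.pi_pos
  rw [Real.le_log_iff_exp_le (by positivity)]
  have he := Real.exp_one_lt_d9
  have hpi := Real.pi_lt_d2
  have h2 : Real.exp 2 = Real.exp 1 ^ 2 := by rw [← Real.exp_nat_mul]; norm_num
  rw [h2, le_div_iff₀ (by positivity)]
  have he0 := Real.exp_pos 1
  nlinarith

/-- **Theorem 7 (2.4) from Theorem 7 (2.3) — the printed deduction (4.10), PROVED.** With
`ℓ = log h + 10` and `ε = 1/(2ℓ) ≤ 1/20`, (2.3) gives `h(−D) > D^{1/2 − 1/(2ℓ)}/(70πℓ)`, and for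
`D ≥ (2000 h ℓ)²` this is `≥ h`: in logarithms, with `M = log(2000 h ℓ)` and `log D ≥ 2M`,
`(½ − 1/(2ℓ)) log D ≥ M − M/ℓ ≥ M − 2 ≥ M − log(2000/(70π)) = log(70πℓh)`, because
`M ≤ 8 + (ℓ − 10) + (ℓ − 1) < 2ℓ` and `70π e² ≤ 2000`. The exceptional discriminant of (2.4) for `h` is
that of (2.3) for this `ε`. [cite: Pintz1977ElementaryVIII, Theorem 7, proof (4.10) p. 97] -/
theorem theorem7b_of_theorem7a (h7 : pintz1977RealZeros_theorem7a) : pintz1977RealZeros_theorem7b := by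
  obtain ⟨D₀, hD₀⟩ := h7
  refine ⟨D₀, fun h hh ↦ ?_⟩
  -- the parameters `ℓ = log h + 10 ≥ 10`, `ε = 1/(2ℓ)`
  set ℓ : ℝ := Real.log h + 10 with hℓdef
  have hh1 : (1 : ℝ) ≤ h := by exact_mod_cast hh
  have hlogh : 0 ≤ Real.log h := Real.log_nonneg hh1
  have hℓ : 10 ≤ ℓ := by rw [hℓdef]; linarith
  have hℓpos : 0 < ℓ := by linarith
  set ε : ℝ := 1 / (2 * ℓ) with hεdef
  have hεpos : 0 < ε := by rw [hεdef]; positivity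
  have hε5 : ε ≤ 1 / 5 := by
    rw [hεdef, div_le_div_iff₀ (by positivity) (by norm_num)]
    linarith
  obtain ⟨dₑ, hdₑ⟩ := hD₀ ε hεpos hε5
  refine ⟨dₑ, fun K _ _ h2 hd hne hD hB ↦ ?_⟩
  have hcl := hdₑ K h2 hd hne hD
  -- abbreviations
  set D : ℝ := ((NumberField.discr K).natAbs : ℝ) with hDdef
  have hDpos : 0 < D := by
    have : (0 : ℝ) < (2000 * (h : ℝ) * (Real.log h + 10)) ^ 2 := by positivity
    exact lt_of_lt_of_le this hB
  have hπ := Real.pi_pos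
  -- the key inequality `70 π ℓ h ≤ D ^ (1/2 − ε)`
  have hM_def : Real.log (2000 * h * ℓ) = Real.log 2000 + Real.log h + Real.log ℓ := by
    rw [Real.log_mul (by positivity) hℓpos.ne', Real.log_mul (by norm_num) (by positivity)]
  have hMle : Real.log (2000 * h * ℓ) ≤ 2 * ℓ - 3 := by
    rw [hM_def]
    have h1 := log_2000_le
    have h3 : Real.log ℓ ≤ ℓ - 1 := Real.log_le_sub_one_of_pos hℓpos
    have h4 : Real.log h = ℓ - 10 := by rw [hℓdef]; ring
    linarith
  have hlogD : 2 * Real.log (2000 * h * ℓ) ≤ Real.log D := by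
    have hsq : Real.log ((2000 * (h : ℝ) * ℓ) ^ 2) = 2 * Real.log (2000 * h * ℓ) := by
      rw [Real.log_pow]; norm_num
    rw [← hsq]
    exact Real.log_le_log (by positivity) hB
  have hexp_le : Real.log (70 * Real.pi * ℓ * h) ≤ (1 / 2 - ε) * Real.log D := by
    have hh0 : (0 : ℝ) < h := by linarith
    -- `log(70πℓh) = M − log(2000/(70π))`
    have hA : Real.log (70 * Real.pi * ℓ * h) = Real.log (70 * Real.pi) + Real.log ℓ + Real.log h := by
      rw [Real.log_mul (by positivity) hh0.ne', Real.log_mul (by positivity) hℓpos.ne']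
    have hB : Real.log (2000 / (70 * Real.pi)) = Real.log 2000 - Real.log (70 * Real.pi) :=
      Real.log_div (by norm_num) (by positivity)
    have hsplit : Real.log (70 * Real.pi * ℓ * h) =
        Real.log (2000 * h * ℓ) - Real.log (2000 / (70 * Real.pi)) := by
      rw [hA, hB, hM_def]; ring
    rw [hsplit]
    have h2 := two_le_log_div
    -- `(1/2 − ε) log D ≥ (1 − 1/ℓ) M = M − M/ℓ ≥ M − 2`
    have h2ε : 2 * ε = 1 / ℓ := by rw [hεdef]; ring
    have hc0 : 0 ≤ 1 / 2 - ε := by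
      have : ε ≤ 1 / 5 := hε5
      linarith
    have hcoef : (1 - 1 / ℓ) * Real.log (2000 * h * ℓ) ≤ (1 / 2 - ε) * Real.log D :=
      calc (1 - 1 / ℓ) * Real.log (2000 * h * ℓ)
          = (1 / 2 - ε) * (2 * Real.log (2000 * h * ℓ)) := by rw [← h2ε]; ring
        _ ≤ (1 / 2 - ε) * Real.log D := mul_le_mul_of_nonneg_left hlogD hc0
    have hMdiv : Real.log (2000 * h * ℓ) / ℓ ≤ 2 := by
      rw [div_le_iff₀ hℓpos]; linarith
    have hexpand : (1 - 1 / ℓ) * Real.log (2000 * h * ℓ) =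
        Real.log (2000 * h * ℓ) - Real.log (2000 * h * ℓ) / ℓ := by
      field_simp
    linarith
  have hkey : 70 * Real.pi * ℓ * h ≤ D ^ (1 / 2 - ε) := by
    have hh0 : (0 : ℝ) < h := by linarith
    rw [Real.rpow_def_of_pos hDpos, ← Real.exp_log (show (0 : ℝ) < 70 * Real.pi * ℓ * h by positivity)]
    exact Real.exp_le_exp.mpr (hexp_le.trans_eq (mul_comm _ _))
  -- conclude: `h ≤ (ε/(35π)) D^{1/2−ε} < h_K`
  have hfinal : (h : ℝ) ≤ ε / (35 * Real.pi) * D ^ (1 / 2 - ε) := by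
    have hε' : ε / (35 * Real.pi) = 1 / (70 * Real.pi * ℓ) := by
      rw [hεdef]; field_simp; ring
    rw [hε', one_div_mul_eq_div, le_div_iff₀ (by positivity)]
    calc (h : ℝ) * (70 * Real.pi * ℓ) = 70 * Real.pi * ℓ * h := by ring
      _ ≤ D ^ (1 / 2 - ε) := hkey
  have hlt : (h : ℝ) < (NumberField.classNumber K : ℝ) := lt_of_le_of_lt hfinal hcl
  exact_mod_cast hlt

/-- **Primitive characters are determined, level included, by their values on `ℕ`**: if `χ` mod `n`
and `ψ` mod `m` are primitive and `χ(k) = ψ(k)` for every natural number `k`, then `n = m`. (Both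
lift to the same character mod `nm`, so `χ` factors through `gcd(n, m)` — Mathlib's
`DirichletCharacter.factorsThrough_gcd` —, whence `n = conductor χ ∣ gcd(n, m) ∣ m`, and
symmetrically.) This is the remark "two primitive characters with the same values on `ℕ` have the
same conductor" behind the value-function rendering of "with at most one exception"
(`AtMostOneException`); in Montgomery–Vaughan's language (§9.1, Lemma 9.1 and the definition of
primitivity: `q` is the least quasiperiod of a primitive `χ` mod `q`, and the least quasiperiod
divides every quasiperiod), equal value functions have the same quasiperiods, so the least ones,
`n` and `m`, agree. [cite: MontgomeryVaughan2007, §9.1 Lemma 9.1] -/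
theorem level_eq_of_isPrimitive_of_apply_natCast_eq {n m : ℕ} [NeZero n] [NeZero m]
    {χ : DirichletCharacter ℂ n} {ψ : DirichletCharacter ℂ m} (hχ : χ.IsPrimitive)
    (hψ : ψ.IsPrimitive) (h : (fun k : ℕ ↦ χ k) = fun k : ℕ ↦ ψ k) : n = m := by
  haveI : NeZero (n * m) := ⟨mul_ne_zero (NeZero.ne n) (NeZero.ne m)⟩
  haveI : NeZero (m * n) := ⟨mul_ne_zero (NeZero.ne m) (NeZero.ne n)⟩
  -- the two lifts to level `nm` agree (they agree on every unit, read through `ℕ`)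
  have key : χ.changeLevel (n.dvd_mul_right m) = ψ.changeLevel (m.dvd_mul_left n) := by
    refine MulChar.ext fun a ↦ ?_
    rw [DirichletCharacter.changeLevel_eq_cast_of_dvd χ _ a,
      DirichletCharacter.changeLevel_eq_cast_of_dvd ψ _ a, ← ZMod.natCast_val, ← ZMod.natCast_val]
    exact congrFun h _
  have key' : ψ.changeLevel (m.dvd_mul_right n) = χ.changeLevel (n.dvd_mul_left m) := by
    refine MulChar.ext fun a ↦ ?_
    rw [DirichletCharacter.changeLevel_eq_cast_of_dvd χ _ a,
      DirichletCharacter.changeLevel_eq_cast_of_dvd ψ _ a, ← ZMod.natCast_val, ← ZMod.natCast_val]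
    exact (congrFun h _).symm
  have h1 : n ∣ m := by
    have hf := DirichletCharacter.factorsThrough_gcd χ ψ key
    have hc : χ.conductor ∣ n.gcd m := DirichletCharacter.conductor_dvd_of_mem_conductorSet χ hf
    rw [hχ] at hc
    exact hc.trans (Nat.gcd_dvd_right n m)
  have h2 : m ∣ n := by
    have hf := DirichletCharacter.factorsThrough_gcd ψ χ key'
    have hc : ψ.conductor ∣ m.gcd n := DirichletCharacter.conductor_dvd_of_mem_conductorSet ψ hf
    rw [hψ] at hc
    exact hc.trans (Nat.gcd_dvd_right m n)
  exact Nat.dvd_antisymm h1 h2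

/-- `√M / M^ε = M^{1/2 − ε}` for `M > 0`. [folklore] -/
private theorem sqrt_div_rpow {M : ℝ} (hM : 0 < M) (ε : ℝ) :
    Real.sqrt M / M ^ ε = M ^ (1 / 2 - ε) := by
  rw [Real.sqrt_eq_rpow, ← Real.rpow_sub hM]

/-- **Theorem 7 (2.3) from Theorem 6 (2.2) — the printed deduction, PROVED** (p. 97: "(2.3) follows
from (2.2) and `h(−D) = (√D/π) L(1, χ_D)` for `D > 4`"). For an imaginary quadratic field `K` with
`D = |d_K| > max(D₀, 4)`, the Kronecker character `κ` mod `D` is real, primitive, `≠ χ₀`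
(`Quadratic.exists_primitive_kroneckerChar`), `w_K = 2`, and the class number formula
`L(1, κ) = 2π h_K/(w_K √D)` (`Quadratic.LFunction_one_eq_of_discr_neg_of_eq`) turns (2.2)
`L(1, κ) > ε/(35 D^ε)` into `h_K > (ε/(35π)) D^{1/2 − ε}`. The exceptional character of Theorem 6
(a value function `E`) becomes the exceptional discriminant `dₑ = −M` of the primitive character with
values `E`, if any (`level_eq_of_isPrimitive_of_apply_natCast_eq`: the level is determined by the
values). [cite: Pintz1977ElementaryVIII, Theorem 7 (2.3), proof p. 97] -/
theorem theorem7a_of_theorem6 (h6 : pintz1977RealZeros_theorem6) : pintz1977RealZeros_theorem7a := by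
  classical
  obtain ⟨D₀, hD₀⟩ := h6
  refine ⟨max D₀ 4, fun ε hε hε5 ↦ ?_⟩
  obtain ⟨E, hE⟩ := hD₀ ε hε hε5
  -- the exceptional discriminant: `−M` for the primitive character mod `M` with values `E`, if any
  have main : ∀ dₑ : ℤ,
      (∀ (M : ℕ) [NeZero M] (κ : DirichletCharacter ℂ M), κ.IsPrimitive →
        ((fun k : ℕ ↦ κ k) = E) → dₑ = -(M : ℤ)) →
      ∀ (K : Type) [Field K] [NumberField K], Module.finrank ℚ K = 2 → NumberField.discr K < 0 →
        NumberField.discr K ≠ dₑ → max D₀ 4 < (NumberField.discr K).natAbs →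
          ε / (35 * Real.pi) * ((NumberField.discr K).natAbs : ℝ) ^ (1 / 2 - ε) <
            (NumberField.classNumber K : ℝ) := by
    intro dₑ hdₑ K _ _ h2 hd hne hD
    obtain ⟨M, _, κ, hM, hκ, hsq, hprim, hfac⟩ :=
      Literature.NumberTheory.QuadraticFields.Quadratic.exists_primitive_kroneckerChar h2
    have hquad : κ.IsQuadratic := by
      intro a
      by_cases ha : IsUnit a
      · have h2' : κ a ^ 2 = 1 := by
          have := congrArg (fun ψ : DirichletCharacter ℂ M ↦ ψ a) hsq
          simpa [MulChar.pow_apply' κ two_ne_zero, MulChar.one_apply ha] using this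
        exact Or.inr (sq_eq_one_iff.mp h2')
      · exact Or.inl (κ.map_nonunit ha)
    have hD₀M : D₀ ≤ M := by rw [hM]; exact le_trans (le_max_left _ _) hD.le
    have hM4 : 4 < M := by rw [hM]; exact lt_of_le_of_lt (le_max_right _ _) hD
    -- `κ` is not the exception: otherwise `dₑ = −M = d_K`
    have hval : (fun k : ℕ ↦ κ k) ≠ E := by
      intro hkE
      have h1 : dₑ = -(M : ℤ) := hdₑ M κ hprim hkE
      apply hne
      rw [h1, hM]
      omega
    have hP := (hE M κ hprim hquad hκ hval hD₀M).2
    -- class number formula with `w_K = 2`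
    have hd4 : NumberField.discr K < -4 := by
      have : (4 : ℤ) < ((NumberField.discr K).natAbs : ℤ) := by rw [← hM]; exact_mod_cast hM4
      omega
    have hcnf := Literature.NumberTheory.QuadraticFields.Quadratic.LFunction_one_eq_of_discr_neg_of_eq
      h2 hd hκ (fun s hs ↦ hfac s (by simpa using hs))
    have hw : (NumberField.Units.torsionOrder K : ℝ) = 2 := by
      exact_mod_cast
        Literature.NumberTheory.QuadraticFields.Quadratic.torsionOrder_eq_two_of_discr_lt_neg_four h2 hd4
    have habs : |(NumberField.discr K : ℝ)| = (M : ℝ) := by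
      rw [← Int.cast_abs, Int.abs_eq_natAbs, Int.cast_natCast, hM]
    rw [hcnf, hw, habs, Complex.ofReal_re] at hP
    have hMpos : (0 : ℝ) < M := by exact_mod_cast lt_trans (by norm_num) hM4
    rw [← hM, ← sqrt_div_rpow hMpos]
    have hπ := Real.pi_pos
    have hsq : 0 < Real.sqrt (M : ℝ) := Real.sqrt_pos.2 hMpos
    have hrp : 0 < (M : ℝ) ^ ε := Real.rpow_pos_of_pos hMpos ε
    rw [div_lt_div_iff₀ (by positivity) (by positivity)] at hP
    rw [show ε / (35 * Real.pi) * (Real.sqrt (M : ℝ) / (M : ℝ) ^ ε) =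
        (ε * Real.sqrt (M : ℝ)) / (35 * Real.pi * (M : ℝ) ^ ε) by
      rw [div_mul_div_comm]]
    rw [div_lt_iff₀ (by positivity)]
    nlinarith
  by_cases hex : ∃ (M : ℕ) (_ : NeZero M) (κ : DirichletCharacter ℂ M),
      κ.IsPrimitive ∧ (fun k : ℕ ↦ κ k) = E
  · obtain ⟨M₀, _, κ₀, hprim₀, hval₀⟩ := hex
    refine ⟨-(M₀ : ℤ), main _ fun M _ κ hprim hval ↦ ?_⟩
    have := level_eq_of_isPrimitive_of_apply_natCast_eq hprim hprim₀ (hval.trans hval₀.symm)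
    rw [this]
  · refine ⟨0, main _ fun M _ κ hprim hval ↦ ?_⟩
    exact absurd ⟨M, inferInstance, κ, hprim, hval⟩ hex

end Pintz1977RealZeros

end Literature.NumberTheory.LFunctions

end
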